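import Literature.NumberTheory.Automorphic.SatakeTransformIwasawa
import HarnessLib

/-!
# An injectivity criterion for the abstract Satake transform: Cartan representatives + dominance ⇒ `𝒮` injective
# (Cartier 1979, proof of Thm. 4.1, steps (b)–(c), axiomatised)

Topic `NumberTheory/Automorphic`; namespace `Literature.NumberTheory.Automorphic.IsIwasawaExponent` (lane `lit-hodgefound`,
Track 2 foundations; seat `lit-hodgefound-p11`, generation 37, row g37-#10).  THEOREMS ONLY: no definition, no named fact,
no instance, no notation.  Sequel of `SatakeTransformIwasawa` (`IsIwasawaExponent P K a`, `satakeVec`, `satakeTransform`):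
the linear-independence argument of Cartier's proof that the Satake transform is injective, run ONCE for every Iwasawa
datum, with the group-specific inputs — a Cartan decomposition and the Bruhat–Tits dominance (4.4.4) (i) — as hypotheses:

* (CARTAN) a set `D ⊆ G` of representatives meeting every double coset: `∀ γ₀ : G/K, ∃ t ∈ D, tK ∈ K·γ₀`;
* (SEPARATION) `a` is injective on `D`;
* (DOMINANCE) a map `φ : Λ → L` to a linear order such that for `t ∈ D` every coset `γ ⊆ KtK` has `a(γ) = a(t)` or
  `φ(a(γ)) < φ(a(t))` (for the classical groups: `φ =` the head-sum vector in the lexicographic order, a linear refinement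
  of the dominance order, and (4.4.4) (i) «si `KtK ∩ B̂⁰t'K ≠ ∅` on a `t' ≤ t`»).

Under these, for any weight `w` and any coefficient domain `R` of characteristic `0`, `h.satakeTransform w` is injective;
and `𝒮(T_t)`, `t ∈ D`, is TRIANGULAR: `x^μ` occurs only for `μ = a(t)` or `φ(μ) < φ(a(t))`, with leading coefficient
`#{γ ⊆ KtK : a(γ) = a(t)} · w(a(t)) ≠ 0`.  The tree's `HyperspecialUnitarySatakeInjective` (g36) is the unitary instance
proved directly; this file makes the argument available to `Sp_{2n}`, `GSp_{2n}` and any further datum.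

## The print

[CartierCorvallis1979] §IV Thm. 4.1, proof: «(b) … `Sc_λ = Σ_μ c(λ, μ) χ_μ` … (c) `c(λ, λ) ≠ 0` [in fact `= δ(λ)^{1/2}`]
and `c(λ, μ) = 0` unless `μ ≤ λ` … hence the `Sc_λ` are linearly independent»; [BruhatTits1972] Prop. (4.4.4): «(i) Si
`K t K ∩ B̂⁰ t' K ≠ ∅`, on a `t' ≤ t`. (ii) `K t K ∩ B̂⁰ t K = t K`» (only (i) and `tK ⊆ KtK ∩ B̂⁰tK` are used);
[Macdonald1995] Ch. V (2.6)–(2.7) (the same triangularity for `GL_n`).  Here the argument is run on an arbitrary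
`K`-invariant vector `v ∈ R[G/K]`: a coset `γ₀ ∈ supp v` maximising `φ ∘ a` has all `γ ∈ supp v` with `a(γ) = a(γ₀)` inside
ONE double coset `K t K`, `t ∈ D` (Cartan + dominance + separation), on which `v` is constant, so the coefficient of
`x^{a(γ₀)}` in `satakeVec v` is `#{…} · w(a(γ₀)) · v(γ₀) ≠ 0`.

## What is formalised (`h : IsIwasawaExponent P K a`, `w : Multiplicative Λ →* R`, `D : Set G`, `φ : Λ → L`)

* §1 `isUnit_weight` (`w(λ)` is a unit), `coeff_satakeVec_eq_card_mul` (the coefficient of `x^μ` when `v` is constant on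
  `{γ ∈ supp v : a(γ) = μ}`).
* §2 **`mem_orbit_of_isMax`** — with (CARTAN), (SEPARATION), (DOMINANCE): if `γ₀ ∈ supp v` maximises `φ ∘ a` then every
  `γ ∈ supp v` with `a(γ) = a(γ₀)` lies in the `K`-orbit of `t₀ K` for THE `t₀ ∈ D` with `a(t₀) = a(γ₀)`.
* §3 **`eq_zero_of_satakeVec_eq_zero`** (`R` a domain of characteristic `0`: a non-zero `K`-invariant vector has non-zero
  transform), **`satakeTransform_injective`** — `h.satakeTransform w` IS INJECTIVE.
* §4 TRIANGULARITY on `D`: `eq_or_lt_of_coeff_satakeTransform_doubleCosetOperator_ne_zero`,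
  `coeff_self_satakeTransform_doubleCosetOperator` (`= #{γ ⊆ KtK : a(γ) = a(t)} · w(a(t))`),
  `coeff_self_satakeTransform_doubleCosetOperator_ne_zero`.

## References
* [CartierCorvallis1979] P. Cartier, *Representations of 𝔭-adic groups: a survey*, PSPM 33.1 (1979), §IV Thm. 4.1, proof
  (b)–(c).
* [BruhatTits1972] F. Bruhat, J. Tits, *Groupes réductifs sur un corps local. I*, Publ. Math. IHÉS 41 (1972), Prop. (4.4.4).
* [Macdonald1995] I. G. Macdonald, *Symmetric Functions and Hall Polynomials*, 2nd ed. (1995), Ch. V (2.6)–(2.7).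
-/

noncomputable section

open scoped Pointwise
open MulAction MonoidAlgebra Representation Finset

namespace Literature.NumberTheory.Automorphic

variable {G : Type*} [Group G] {Λ : Type*} [AddCommGroup Λ] {R : Type*} [CommRing R]

namespace IsIwasawaExponent

/-! ## §1 Units and the coefficient formula on a constancy set -/

/-- A weight `w : Multiplicative Λ →* R` takes unit values (`w(λ) w(-λ) = 1`). [cite: CartierCorvallis1979, §IV (4.2)] -/
theorem isUnit_weight (w : Multiplicative Λ →* R) (x : Multiplicative Λ) : IsUnit (w x) :=
  (Group.isUnit x).map w

/-- If `v` takes the constant value `c` on `{γ ∈ supp v : a(γ) = μ}`, the coefficient of `x^μ` in `satakeVec v` is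
`w(μ) · #{γ ∈ supp v : a(γ) = μ} · c`. [cite: CartierCorvallis1979, §IV, proof of Thm. 4.1 (b)] -/
theorem coeff_satakeVec_eq_card_mul (K : Subgroup G) (a : G → Λ) (w : Multiplicative Λ →* R)
    (v : MonoidAlgebra R (G ⧸ K)) (μ : Λ) [DecidablePred fun γ : G ⧸ K => a γ.out = μ] {c : R}
    (hc : ∀ γ ∈ v.coeff.support, a γ.out = μ → v.coeff γ = c) :
    (satakeVec K a w v).coeff μ =
      w (Multiplicative.ofAdd μ) * (((v.coeff.support.filter fun γ => a γ.out = μ).card : R) * c) := by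
  rw [coeff_satakeVec, Finset.sum_congr rfl fun γ hγ => hc γ (Finset.mem_filter.1 hγ).1 (Finset.mem_filter.1 hγ).2,
    Finset.sum_const, nsmul_eq_mul]

/-! ## §2 The cosets with a maximal exponent lie in one double coset -/

variable {P K : Subgroup G} {a : G → Λ} {L : Type*} [LinearOrder L]

/-- **The cosets with a `φ`-MAXIMAL exponent lie in one double coset.**  Hypotheses: (CARTAN) `D` meets every double coset;
(SEPARATION) `a` is injective on `D`; (DOMINANCE) for `t ∈ D`, every `γ ⊆ KtK` has `a(γ) = a(t)` or `φ(a(γ)) < φ(a(t))`.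
If `v ∈ R[G/K]` is `K`-invariant and `γ₀ ∈ supp v` maximises `φ ∘ a` on `supp v`, then there is `t₀ ∈ D` with
`a(t₀) = a(γ₀)` such that every `γ ∈ supp v` with `a(γ) = a(γ₀)` lies in the `K`-orbit of `t₀K`.
[cite: BruhatTits1972, Prop. (4.4.4) (i)] [cite: CartierCorvallis1979, §IV, proof of Thm. 4.1] -/
theorem mem_orbit_of_isMax (h : IsIwasawaExponent P K a) {D : Set G} {φ : Λ → L}
    (hcartan : ∀ γ₀ : G ⧸ K, ∃ t ∈ D, (t : G ⧸ K) ∈ orbit K γ₀) (hsep : Set.InjOn a D)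
    (hdom : ∀ t ∈ D, ∀ γ ∈ orbit K (t : G ⧸ K), a γ.out = a t ∨ φ (a γ.out) < φ (a t))
    {v : MonoidAlgebra R (G ⧸ K)} (hv : ∀ k ∈ K, ofMulAction R G (G ⧸ K) k v = v) {γ₀ : G ⧸ K} (hγ₀ : γ₀ ∈ v.coeff.support)
    (hmax : ∀ γ ∈ v.coeff.support, φ (a γ.out) ≤ φ (a γ₀.out)) :
    ∃ t₀ ∈ D, a t₀ = a γ₀.out ∧
      ∀ γ ∈ v.coeff.support, a γ.out = a γ₀.out → γ ∈ orbit K (t₀ : G ⧸ K) := by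
  -- the representative of `γ₀`'s double coset has exponent `a(γ₀)`
  have key : ∀ γ ∈ v.coeff.support, a γ.out = a γ₀.out → ∃ t ∈ D, a t = a γ₀.out ∧ γ ∈ orbit K (t : G ⧸ K) := by
    intro γ hγ hγe
    obtain ⟨t, htD, ht⟩ := hcartan γ
    have hγt : γ ∈ orbit K (t : G ⧸ K) := by
      rw [MulAction.orbit_eq_iff.2 ht]
      exact MulAction.mem_orbit_self _
    -- `tK ∈ supp v` (invariance), so `φ(a t) ≤ φ(a γ₀) = φ(a γ)`
    have htS : (t : G ⧸ K) ∈ v.coeff.support := by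
      rw [Finsupp.mem_support_iff, heckeAlgebra.coeff_eq_of_mem_orbit K hv ht]
      exact Finsupp.mem_support_iff.1 hγ
    have h1 := hmax _ htS
    rw [h.apply_out_coe] at h1
    rcases hdom t htD γ hγt with heq | hlt
    · exact ⟨t, htD, heq ▸ hγe, hγt⟩
    · rw [hγe] at hlt
      exact absurd h1 (not_le.2 hlt)
  obtain ⟨t₀, ht₀D, ht₀, -⟩ := key γ₀ hγ₀ rfl
  refine ⟨t₀, ht₀D, ht₀, fun γ hγ hγe => ?_⟩
  obtain ⟨t, htD, ht, hγt⟩ := key γ hγ hγe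
  rwa [hsep htD ht₀D (ht.trans ht₀.symm)] at hγt

/-! ## §3 Injectivity -/

/-- **A non-zero `K`-invariant vector has a non-zero transform** (`R` a domain of characteristic `0`): with `γ₀ ∈ supp v`
maximising `φ ∘ a` and `μ = a(γ₀)`, the coefficient of `x^μ` in `satakeVec v` is `w(μ) · #{γ ∈ supp v : a(γ) = μ} · v(γ₀)`
(all such `γ` lie in one double coset, on which `v` is constant), which is non-zero.
[cite: CartierCorvallis1979, §IV, proof of Thm. 4.1 (b)–(c)] [cite: BruhatTits1972, Prop. (4.4.4) (i)] -/
theorem eq_zero_of_satakeVec_eq_zero [IsDomain R] [CharZero R] (h : IsIwasawaExponent P K a) (w : Multiplicative Λ →* R)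
    {D : Set G} {φ : Λ → L} (hcartan : ∀ γ₀ : G ⧸ K, ∃ t ∈ D, (t : G ⧸ K) ∈ orbit K γ₀) (hsep : Set.InjOn a D)
    (hdom : ∀ t ∈ D, ∀ γ ∈ orbit K (t : G ⧸ K), a γ.out = a t ∨ φ (a γ.out) < φ (a t))
    {v : MonoidAlgebra R (G ⧸ K)} (hv : ∀ k ∈ K, ofMulAction R G (G ⧸ K) k v = v) (h0 : satakeVec K a w v = 0) :
    v = 0 := by
  classical
  by_contra hne
  have hSne : v.coeff.support.Nonempty := by
    rw [Finsupp.support_nonempty_iff, Ne, MonoidAlgebra.coeff_eq_zero]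
    exact hne
  obtain ⟨γ₀, hγ₀S, hmax⟩ := v.coeff.support.exists_max_image (fun γ => φ (a γ.out)) hSne
  obtain ⟨t₀, -, -, horb⟩ := h.mem_orbit_of_isMax hcartan hsep hdom hv hγ₀S hmax
  -- `v` is constant (= `v γ₀`) on `{γ ∈ supp v : a γ = a γ₀}`
  have hconst : ∀ γ ∈ v.coeff.support, a γ.out = a γ₀.out → v.coeff γ = v.coeff γ₀ := fun γ hγ hγe =>
    (heckeAlgebra.coeff_eq_of_mem_orbit K hv (horb γ hγ hγe)).trans
      (heckeAlgebra.coeff_eq_of_mem_orbit K hv (horb γ₀ hγ₀S rfl)).symm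
  have hcoef := coeff_satakeVec_eq_card_mul K a w v (a γ₀.out) hconst
  rw [h0, AddMonoidAlgebra.coeff_zero, Finsupp.zero_apply] at hcoef
  have hγ₀f : γ₀ ∈ v.coeff.support.filter fun γ => a γ.out = a γ₀.out := Finset.mem_filter.2 ⟨hγ₀S, rfl⟩
  refine absurd hcoef.symm (mul_ne_zero (isUnit_weight w _).ne_zero (mul_ne_zero ?_ (Finsupp.mem_support_iff.1 hγ₀S)))
  exact Nat.cast_ne_zero.2 (Finset.card_ne_zero.2 ⟨γ₀, hγ₀f⟩)

/-- **INJECTIVITY OF THE SATAKE TRANSFORM** from (CARTAN) + (SEPARATION) + (DOMINANCE), for every weight `w` and every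
coefficient domain of characteristic `0`: `𝒮(T) = satakeVec (T[K])` with `T[K]` a `K`-invariant vector that determines `T`
(`heckeAlgebra.toVector_injective`). [cite: CartierCorvallis1979, §IV Thm. 4.1 (injectivity half)]
[cite: BruhatTits1972, Prop. (4.4.4) (i)] -/
theorem satakeTransform_injective [IsDomain R] [CharZero R] (h : IsIwasawaExponent P K a) (w : Multiplicative Λ →* R)
    {D : Set G} {φ : Λ → L} (hcartan : ∀ γ₀ : G ⧸ K, ∃ t ∈ D, (t : G ⧸ K) ∈ orbit K γ₀) (hsep : Set.InjOn a D)
    (hdom : ∀ t ∈ D, ∀ γ ∈ orbit K (t : G ⧸ K), a γ.out = a t ∨ φ (a γ.out) < φ (a t)) :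
    Function.Injective (h.satakeTransform w) := by
  refine (injective_iff_map_eq_zero _).2 fun T hT => ?_
  rw [satakeTransform_apply] at hT
  have hv := h.eq_zero_of_satakeVec_eq_zero w hcartan hsep hdom (fun k hk => heckeAlgebra.ofMulAction_toVector K T hk) hT
  exact heckeAlgebra.toVector_injective K (by rw [hv, map_zero])

/-! ## §4 Triangularity of `𝒮(T_t)` for `t ∈ D` -/

variable [IsHeckeTriple (⊤ : Submonoid G) K K]

/-- **Triangularity**: for `t ∈ D`, if `x^μ` occurs in `𝒮(T_t)` then `μ = a(t)` or `φ(μ) < φ(a(t))` (only (DOMINANCE) is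
used). [cite: CartierCorvallis1979, §IV, proof of Thm. 4.1 (c)] [cite: BruhatTits1972, Prop. (4.4.4) (i)] -/
theorem eq_or_lt_of_coeff_satakeTransform_doubleCosetOperator_ne_zero (h : IsIwasawaExponent P K a)
    (w : Multiplicative Λ →* R) {D : Set G} {φ : Λ → L}
    (hdom : ∀ t ∈ D, ∀ γ ∈ orbit K (t : G ⧸ K), a γ.out = a t ∨ φ (a γ.out) < φ (a t)) {t : G} (ht : t ∈ D) {μ : Λ}
    (hμ : (h.satakeTransform w (heckeAlgebra.doubleCosetOperator K t)).coeff μ ≠ 0) : μ = a t ∨ φ μ < φ (a t) := by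
  by_contra hnot
  refine hμ (h.coeff_satakeTransform_doubleCosetOperator_eq_zero w fun γ hγ heq => hnot ?_)
  rw [← heq]
  exact hdom t ht γ hγ

/-- **The leading coefficient**: the coefficient of `x^{a(t)}` in `𝒮(T_t)` is `#{γ ⊆ KtK : a(γ) = a(t)} · w(a(t))` (no
hypothesis). [cite: CartierCorvallis1979, §IV, proof of Thm. 4.1 (c) («`c(λ, λ) = δ(λ)^{1/2}`» when the count is `1`)] -/
theorem coeff_self_satakeTransform_doubleCosetOperator (h : IsIwasawaExponent P K a) (w : Multiplicative Λ →* R) (t : G)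
    [DecidablePred fun γ : G ⧸ K => a γ.out = a t] :
    (h.satakeTransform w (heckeAlgebra.doubleCosetOperator K t)).coeff (a t) =
      (((finite_orbit_quotient K t).toFinset.filter fun γ => a γ.out = a t).card : R) * w (Multiplicative.ofAdd (a t)) :=
  h.coeff_satakeTransform_doubleCosetOperator w t (a t)

/-- **The leading coefficient is non-zero** over a domain of characteristic `0` (the coset `tK` itself contributes).
[cite: CartierCorvallis1979, §IV, proof of Thm. 4.1 (c)] [cite: BruhatTits1972, Prop. (4.4.4) (ii) (`⊇`)] -/
theorem coeff_self_satakeTransform_doubleCosetOperator_ne_zero [IsDomain R] [CharZero R] (h : IsIwasawaExponent P K a)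
    (w : Multiplicative Λ →* R) (t : G) : (h.satakeTransform w (heckeAlgebra.doubleCosetOperator K t)).coeff (a t) ≠ 0 := by
  classical
  rw [h.coeff_self_satakeTransform_doubleCosetOperator]
  refine mul_ne_zero (Nat.cast_ne_zero.2 (Finset.card_ne_zero.2 ⟨(t : G ⧸ K), Finset.mem_filter.2 ⟨?_, h.apply_out_coe t⟩⟩))
    (isUnit_weight w _).ne_zero
  exact (Set.Finite.mem_toFinset _).2 (MulAction.mem_orbit_self _)

end IsIwasawaExponent

end Literature.NumberTheory.Automorphic

end
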